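import Literature.Analysis.FluidPDE.GaussianVortexFormDomain
import Mathlib.Analysis.SpecialFunctions.SmoothTransition
import Mathlib.Analysis.Calculus.MeanValue
import Mathlib.Analysis.Calculus.LocalExtr.Basic
import Mathlib.MeasureTheory.Function.ConvergenceInMeasure
import Mathlib.MeasureTheory.Integral.DominatedConvergence
import HarnessLib

/-!
# Truncations in the form domain `H¹(μ_λ)`: `u ∈ H ⟹ u⁻ ∈ H` with `∇u⁻ = −1_{u<0} ∇u`

Analysis/FluidPDE file (all results proved, no definitions, no named facts), part of the
existence theory behind the named fact `GallayMaekawa2016_thm41` (Gallay–Maekawa 2016, Thm. 4.1: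
asymmetric Burgers vortices for all circulations, by a Leray–Schauder argument). The weak
maximum principle for the drift-perturbed operator `κ − L_λ + v·∇` (Stampacchia's truncation
method) needs the negative part of an element of the weighted Sobolev space
`H = gaussLamFormDomain lam` (the closure of the graphs `(ψ, ∇ψ)` of test functions in
`L²(μ_λ) × L²(μ_λ; ℝ²)`), together with the chain rule for its weak gradient:

* `mem_gaussLamFormDomain_of_tendsto` — closure principle in components;
* `comp_mem_gaussLamFormDomain` — **chain rule in `H`**: for `f ∈ C^∞(ℝ)` with `f(0) = 0` and
  `|f'| ≤ L`, `(u, G) ∈ H ⟹ (f∘u, (f'∘u) G) ∈ H` (approximate `u` by test functions `ψₙ → u`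
  a.e. and in `H`; `f∘ψₙ` are test functions with `∇(f∘ψₙ) = f'(ψₙ)∇ψₙ`; dominated convergence);
* `truncFun ε s = −s θ(−s/ε)` (`θ` = `Real.smoothTransition`), smooth one-sided approximations of
  `s ↦ s⁻ = max(−s, 0)` with `truncFun ε 0 = 0`, `|truncFun ε s| ≤ |s|`, uniformly bounded
  derivatives `truncDeriv ε s → −1_{s<0}` (exactly, eventually) as `ε = 1/(n+1) → 0`;
* `negPart_mem_gaussLamFormDomain` — **`(u⁻, −1_{u<0} G) ∈ H`** for `(u, G) ∈ H`, and the pointwise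
  identities `u u⁻ = −(u⁻)²`, `⟪G, G⁻⟫ = −‖G⁻‖²`, `u • G⁻ = −u⁻ • G⁻` used in the maximum principle
  (Gilbarg–Trudinger, Lemma 7.6 and Thm. 8.1, in the Gaussian-weighted setting).

## References

* D. Gilbarg, N. S. Trudinger, *Elliptic Partial Differential Equations of Second Order*,
  Springer (2001), Lemma 7.6 (chain rule / positive part in `W^{1,p}`), Thm. 8.1 (weak maximum
  principle). [GilbargTrudinger2001]
* Th. Gallay, Y. Maekawa, *Existence and stability of viscous vortices*, arXiv:1610.08384, §4.1,
  Thm. 4.1. [GallayMaekawa2016]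
-/

open MeasureTheory Filter Set WithLp Metric
open scoped Real RealInnerProductSpace Topology InnerProductSpace ContDiff NNReal

noncomputable section

namespace Literature.Analysis.FluidPDE

variable {lam : ℝ}

/-! ### Generic `L²` tools -/

section L2Tools

variable {X : Type*} [MeasurableSpace X] {μ : Measure X}
variable {E : Type*} [NormedAddCommGroup E] [InnerProductSpace ℝ E]

/-- `‖v‖² = ∫ ‖v‖² dμ` for `v ∈ L²(μ; E)`, `E` a real inner product space. [folklore] -/
theorem norm_sq_Lp_two_eq_integral_norm_sq (v : Lp E 2 μ) :
    ‖v‖ ^ 2 = ∫ x, ‖(v : X → E) x‖ ^ 2 ∂μ := by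
  rw [← real_inner_self_eq_norm_sq, L2.inner_def]
  refine integral_congr_ae (Eventually.of_forall fun x => ?_)
  simp only
  rw [real_inner_self_eq_norm_sq]

/-- **Dominated convergence in `L²(μ; E)`**: if `Fₙ → f` a.e. with `‖Fₙ − f‖ ≤ g` a.e.,
`g² ∈ L¹`, then `Fₙ → f` in `L²`. [folklore] -/
theorem tendsto_toLp_two_of_dominated {F : ℕ → X → E} {f : X → E} (hF : ∀ n, MemLp (F n) 2 μ)
    (hf : MemLp f 2 μ) (g : X → ℝ) (hg : Integrable (fun x => g x ^ 2) μ)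
    (hle : ∀ n, ∀ᵐ x ∂μ, ‖F n x - f x‖ ≤ g x)
    (hlim : ∀ᵐ x ∂μ, Tendsto (fun n => F n x) atTop (𝓝 (f x))) :
    Tendsto (fun n => (hF n).toLp (F n)) atTop (𝓝 (hf.toLp f)) := by
  rw [tendsto_iff_norm_sub_tendsto_zero]
  have hsq : ∀ n, ‖(hF n).toLp (F n) - hf.toLp f‖ ^ 2 = ∫ x, ‖F n x - f x‖ ^ 2 ∂μ := by
    intro n
    rw [← MemLp.toLp_sub, norm_sq_Lp_two_eq_integral_norm_sq]
    refine integral_congr_ae ?_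
    filter_upwards [MemLp.coeFn_toLp ((hF n).sub hf)] with x hx
    rw [hx, Pi.sub_apply]
  have hlim2 : Tendsto (fun n => ∫ x, ‖F n x - f x‖ ^ 2 ∂μ) atTop (𝓝 0) := by
    have h := tendsto_integral_of_dominated_convergence (μ := μ)
      (F := fun n x => ‖F n x - f x‖ ^ 2) (f := fun _ => 0) (fun x => g x ^ 2)
      (fun n => (((hF n).sub hf).aestronglyMeasurable.norm.pow 2))
      hg (fun n => ?_) ?_
    · simpa using h
    · filter_upwards [hle n] with x hx
      rw [Real.norm_of_nonneg (by positivity)]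
      exact pow_le_pow_left₀ (norm_nonneg _) hx 2
    · filter_upwards [hlim] with x hx
      have : Tendsto (fun n => ‖F n x - f x‖) atTop (𝓝 0) := by
        rw [← tendsto_iff_norm_sub_tendsto_zero]; exact hx
      simpa using this.pow 2
  have h0 : Tendsto (fun n => ‖(hF n).toLp (F n) - hf.toLp f‖ ^ 2) atTop (𝓝 0) := by
    simp_rw [hsq]; exact hlim2
  have := (Real.continuous_sqrt.tendsto 0).comp h0
  simpa [Function.comp_def, Real.sqrt_sq (norm_nonneg _)] using this

/-- An `Lp`-convergent sequence has an a.e. convergent subsequence. [folklore] -/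
theorem exists_subseq_tendsto_ae_of_tendsto_Lp {F' : Type*} [NormedAddCommGroup F']
    {v : ℕ → Lp F' 2 μ} {w : Lp F' 2 μ} (h : Tendsto v atTop (𝓝 w)) :
    ∃ ns : ℕ → ℕ, StrictMono ns ∧
      ∀ᵐ x ∂μ, Tendsto (fun k => (v (ns k) : X → F') x) atTop (𝓝 ((w : X → F') x)) :=
  (tendstoInMeasure_of_tendsto_Lp h).exists_seq_tendsto_ae

end L2Tools

/-! ### Closure principle in components -/

section Closure

/-- **Closure principle for `H¹(μ_λ)` in components**: if `Vₙ ∈ H`, `Vₙ.fst → a` in `L²(μ_λ)` and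
`Vₙ.snd → b` in `L²(μ_λ; ℝ²)`, then `(a, b) ∈ H`. [folklore] -/
theorem mem_gaussLamFormDomain_of_tendsto
    {V : ℕ → WithLp 2 (Lp ℝ 2 (gaussLamMeasure lam) ×
      Lp (EuclideanSpace ℝ (Fin 2)) 2 (gaussLamMeasure lam))}
    (hV : ∀ n, V n ∈ gaussLamFormDomain lam) {a : Lp ℝ 2 (gaussLamMeasure lam)}
    {b : Lp (EuclideanSpace ℝ (Fin 2)) 2 (gaussLamMeasure lam)}
    (ha : Tendsto (fun n => (V n).fst) atTop (𝓝 a))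
    (hb : Tendsto (fun n => (V n).snd) atTop (𝓝 b)) :
    (toLp 2 (a, b) : WithLp 2 (Lp ℝ 2 (gaussLamMeasure lam) ×
      Lp (EuclideanSpace ℝ (Fin 2)) 2 (gaussLamMeasure lam))) ∈ gaussLamFormDomain lam := by
  have hc : Continuous fun q : Lp ℝ 2 (gaussLamMeasure lam) ×
      Lp (EuclideanSpace ℝ (Fin 2)) 2 (gaussLamMeasure lam) =>
      (toLp 2 q : WithLp 2 (Lp ℝ 2 (gaussLamMeasure lam) ×
        Lp (EuclideanSpace ℝ (Fin 2)) 2 (gaussLamMeasure lam))) :=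
    WithLp.prod_continuous_toLp 2 _ _
  have hlim : Tendsto V atTop (𝓝 (toLp 2 (a, b))) := by
    have h := (hc.tendsto _).comp (ha.prodMk_nhds hb)
    have heq : (fun n => toLp 2 ((V n).fst, (V n).snd)) = V := funext fun n => rfl
    rw [← heq]
    exact h
  exact (isClosed_gaussLamFormDomain lam).mem_of_tendsto hlim (Eventually.of_forall hV)

/-- Elements of `H¹(μ_λ)` are limits of graphs of test functions `ψₙ` which moreover converge
almost everywhere (first components). [folklore] -/
theorem exists_seq_tendsto_gaussLamGraph_ae
    {U : WithLp 2 (Lp ℝ 2 (gaussLamMeasure lam) × Lp (EuclideanSpace ℝ (Fin 2)) 2 (gaussLamMeasure lam))}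
    (hU : U ∈ gaussLamFormDomain lam) :
    ∃ φ : ℕ → planarTestFunctions, Tendsto (fun n => gaussLamGraph lam (φ n)) atTop (𝓝 U) ∧
      ∀ᵐ x ∂gaussLamMeasure lam, Tendsto (fun n => (φ n : EuclideanSpace ℝ (Fin 2) → ℝ) x) atTop
        (𝓝 ((U.fst : EuclideanSpace ℝ (Fin 2) → ℝ) x)) := by
  have hUc : U ∈ closure ((LinearMap.range (gaussLamGraph lam) : Submodule ℝ _) : Set _) := by
    rw [← Submodule.topologicalClosure_coe]; exact hU
  obtain ⟨a, ha, hal⟩ := mem_closure_iff_seq_limit.1 hUc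
  have hex : ∀ n, ∃ φ : planarTestFunctions, gaussLamGraph lam φ = a n := fun n => by
    have := ha n
    rwa [SetLike.mem_coe, LinearMap.mem_range] at this
  choose φ hφ using hex
  have hlim : Tendsto (fun n => gaussLamGraph lam (φ n)) atTop (𝓝 U) := by
    have : (fun n => gaussLamGraph lam (φ n)) = a := funext hφ
    rw [this]; exact hal
  have h1 : Tendsto (fun n => (gaussLamGraph lam (φ n)).fst) atTop (𝓝 U.fst) :=
    ((WithLp.continuous_fst _ _ _).tendsto U).comp hlim
  obtain ⟨ns, hns, hae⟩ := exists_subseq_tendsto_ae_of_tendsto_Lp h1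
  refine ⟨φ ∘ ns, hlim.comp hns.tendsto_atTop, ?_⟩
  filter_upwards [hae, ae_all_iff.2 fun n =>
    MemLp.coeFn_toLp (memLp_planarTestFunction lam (φ n))] with x hx hx'
  simp only [Function.comp_apply]
  refine hx.congr fun k => ?_
  rw [gaussLamGraph_fst, hx' (ns k)]

end Closure

/-! ### The chain rule in `H¹(μ_λ)` -/

section ChainRule

variable {f : ℝ → ℝ} {L : ℝ≥0}

/-- A smooth `f` with `|f'| ≤ L` is `L`-Lipschitz. [folklore] -/
theorem lipschitzWith_of_deriv_bound (hf : ContDiff ℝ 1 f) (hL : ∀ s, ‖deriv f s‖ ≤ L) :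
    LipschitzWith L f :=
  lipschitzWith_of_nnnorm_deriv_le (hf.differentiable (by simp)) fun s => by
    rw [← NNReal.coe_le_coe, coe_nnnorm]; exact hL s

/-- The composite gradient `(f'∘u) G` lies in `L²(μ_λ; ℝ²)`. [folklore] -/
theorem memLp_deriv_comp_smul (hf : ContDiff ℝ 1 f) (hL : ∀ s, ‖deriv f s‖ ≤ L)
    (u : Lp ℝ 2 (gaussLamMeasure lam)) (G : Lp (EuclideanSpace ℝ (Fin 2)) 2 (gaussLamMeasure lam)) :
    MemLp (fun x => deriv f ((u : EuclideanSpace ℝ (Fin 2) → ℝ) x) •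
      (G : EuclideanSpace ℝ (Fin 2) → EuclideanSpace ℝ (Fin 2)) x) 2 (gaussLamMeasure lam) := by
  have hcont : Continuous (deriv f) := hf.continuous_deriv (by simp)
  refine MemLp.of_le_mul (c := L) (Lp.memLp G) ?_ (Eventually.of_forall fun x => ?_)
  · exact (hcont.comp_aestronglyMeasurable (Lp.aestronglyMeasurable u)).smul
      (Lp.aestronglyMeasurable G)
  · rw [norm_smul]
    exact mul_le_mul_of_nonneg_right (hL _) (norm_nonneg _)

/-- Composition with a smooth `f`, `f 0 = 0`, maps test functions to test functions. [folklore] -/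
theorem comp_mem_planarTestFunctions (hf : ContDiff ℝ ∞ f) (hf0 : f 0 = 0)
    (ψ : planarTestFunctions) :
    (fun x => f ((ψ : EuclideanSpace ℝ (Fin 2) → ℝ) x)) ∈ planarTestFunctions :=
  ⟨hf.comp (planarTestFunctions.contDiff ψ),
    (planarTestFunctions.hasCompactSupport ψ).comp_left hf0⟩

/-- **Chain rule for gradients**: `∇(f∘ψ)(x) = f'(ψ x) • ∇ψ(x)`. [folklore] -/
theorem gradient_comp_eq_deriv_smul {ψ : EuclideanSpace ℝ (Fin 2) → ℝ} {x : EuclideanSpace ℝ (Fin 2)}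
    (hf : DifferentiableAt ℝ f (ψ x)) (hψ : DifferentiableAt ℝ ψ x) :
    gradient (fun y => f (ψ y)) x = deriv f (ψ x) • gradient ψ x := by
  have hcomp : fderiv ℝ (fun y => f (ψ y)) x = (fderiv ℝ f (ψ x)).comp (fderiv ℝ ψ x) :=
    fderiv_comp x hf hψ
  have hsmul : (fderiv ℝ f (ψ x)).comp (fderiv ℝ ψ x) = deriv f (ψ x) • fderiv ℝ ψ x := by
    ext v
    rw [ContinuousLinearMap.comp_apply, FunLike.coe_smul, Pi.smul_apply,
      ← toSpanSingleton_deriv, ContinuousLinearMap.toSpanSingleton_apply, smul_eq_mul,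
      smul_eq_mul, mul_comm]
  rw [gradient, hcomp, hsmul, map_smul, gradient]

/-- **Chain rule in `H¹(μ_λ)`** (Gilbarg–Trudinger, Lemma 7.5, Gaussian-weighted form): for
`f ∈ C^∞(ℝ)` with `f(0) = 0` and `|f'| ≤ L`, if `U = (u, G) ∈ H` then `(f∘u, (f'∘u) G) ∈ H`.
Proof: test functions `ψₙ` with `(ψₙ, ∇ψₙ) → U` in `H` and `ψₙ → u` a.e.; the test functions
`f∘ψₙ` have `∇(f∘ψₙ) = f'(ψₙ)∇ψₙ`; `f∘ψₙ → f∘u` (`f` Lipschitz) and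
`f'(ψₙ)∇ψₙ − f'(u)G = f'(ψₙ)(∇ψₙ − G) + (f'(ψₙ) − f'(u))G → 0` in `L²` (bound `L`, dominated
convergence). [cite: GilbargTrudinger2001, Lemma 7.5] -/
theorem comp_mem_gaussLamFormDomain (hf : ContDiff ℝ ∞ f) (hf0 : f 0 = 0)
    (hL : ∀ s, ‖deriv f s‖ ≤ L)
    {U : WithLp 2 (Lp ℝ 2 (gaussLamMeasure lam) × Lp (EuclideanSpace ℝ (Fin 2)) 2 (gaussLamMeasure lam))}
    (hU : U ∈ gaussLamFormDomain lam) :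
    (toLp 2 ((lipschitzWith_of_deriv_bound (hf.of_le (by simp)) hL).compLp hf0 U.fst,
      (memLp_deriv_comp_smul (hf.of_le (by simp)) hL U.fst U.snd).toLp _) :
      WithLp 2 (Lp ℝ 2 (gaussLamMeasure lam) ×
        Lp (EuclideanSpace ℝ (Fin 2)) 2 (gaussLamMeasure lam))) ∈ gaussLamFormDomain lam := by
  have hf1 : ContDiff ℝ 1 f := hf.of_le (by simp)
  set hLip := lipschitzWith_of_deriv_bound hf1 hL with hLip_def
  have hcontd : Continuous (deriv f) := hf1.continuous_deriv (by simp)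
  have hdiff : Differentiable ℝ f := hf1.differentiable (by simp)
  obtain ⟨ψ, hlim, hae⟩ := exists_seq_tendsto_gaussLamGraph_ae hU
  have h1 : Tendsto (fun n => (gaussLamGraph lam (ψ n)).fst) atTop (𝓝 U.fst) :=
    ((WithLp.continuous_fst _ _ _).tendsto U).comp hlim
  have h2 : Tendsto (fun n => (gaussLamGraph lam (ψ n)).snd) atTop (𝓝 U.snd) :=
    ((WithLp.continuous_snd _ _ _).tendsto U).comp hlim
  -- the composed test functions
  set χ : ℕ → planarTestFunctions := fun n => ⟨_, comp_mem_planarTestFunctions hf hf0 (ψ n)⟩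
    with hχ
  have hχ_apply : ∀ n x, (χ n : EuclideanSpace ℝ (Fin 2) → ℝ) x =
      f ((ψ n : EuclideanSpace ℝ (Fin 2) → ℝ) x) := fun n x => rfl
  have hχ_grad : ∀ n x, gradient (χ n : EuclideanSpace ℝ (Fin 2) → ℝ) x =
      deriv f ((ψ n : EuclideanSpace ℝ (Fin 2) → ℝ) x) •
        gradient (ψ n : EuclideanSpace ℝ (Fin 2) → ℝ) x := fun n x =>
    gradient_comp_eq_deriv_smul (hdiff _)
      (((planarTestFunctions.contDiff (ψ n)).differentiable (by simp)) x)
  refine mem_gaussLamFormDomain_of_tendsto (fun n => gaussLamGraph_mem lam (χ n)) ?_ ?_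
  · -- first components: `f ∘ ψₙ → f ∘ u`
    have heq : ∀ n, (gaussLamGraph lam (χ n)).fst = hLip.compLp hf0 (gaussLamGraph lam (ψ n)).fst := by
      intro n
      refine Lp.ext ?_
      rw [gaussLamGraph_fst, gaussLamGraph_fst]
      filter_upwards [MemLp.coeFn_toLp (memLp_planarTestFunction lam (χ n)),
        hLip.coeFn_compLp hf0 ((memLp_planarTestFunction lam (ψ n)).toLp _),
        MemLp.coeFn_toLp (memLp_planarTestFunction lam (ψ n))] with x h1x h2x h3x
      rw [h1x, h2x, Function.comp_apply, h3x, hχ_apply]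
    rw [tendsto_iff_norm_sub_tendsto_zero]
    have hb : ∀ n, ‖(gaussLamGraph lam (χ n)).fst - hLip.compLp hf0 U.fst‖ ≤
        L * ‖(gaussLamGraph lam (ψ n)).fst - U.fst‖ := fun n => by
      rw [heq]; exact hLip.norm_compLp_sub_le hf0 _ _
    have h0 : Tendsto (fun n => (L : ℝ) * ‖(gaussLamGraph lam (ψ n)).fst - U.fst‖) atTop (𝓝 0) := by
      have := (tendsto_iff_norm_sub_tendsto_zero.1 h1).const_mul (L : ℝ)
      simpa using this
    exact squeeze_zero (fun n => norm_nonneg _) hb h0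
  · -- second components: `f'(ψₙ) ∇ψₙ → f'(u) G`
    set u : EuclideanSpace ℝ (Fin 2) → ℝ := (U.fst : EuclideanSpace ℝ (Fin 2) → ℝ) with hu
    set G : EuclideanSpace ℝ (Fin 2) → EuclideanSpace ℝ (Fin 2) :=
      (U.snd : EuclideanSpace ℝ (Fin 2) → EuclideanSpace ℝ (Fin 2)) with hG
    -- the intermediate sequence `Bₙ = f'(ψₙ) G`
    have hBmem : ∀ n, MemLp (fun x => deriv f ((ψ n : EuclideanSpace ℝ (Fin 2) → ℝ) x) • G x) 2
        (gaussLamMeasure lam) := fun n => by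
      refine MemLp.of_le_mul (c := L) (Lp.memLp U.snd) ?_ (Eventually.of_forall fun x => ?_)
      · exact (hcontd.comp (planarTestFunctions.continuous (ψ n))).aestronglyMeasurable.smul
          (Lp.aestronglyMeasurable U.snd)
      · rw [norm_smul]; exact mul_le_mul_of_nonneg_right (hL _) (norm_nonneg _)
    have hbmem := memLp_deriv_comp_smul hf1 hL U.fst U.snd
    -- (a) `‖Aₙ − Bₙ‖ ≤ L ‖∇ψₙ − G‖ → 0`
    have hAB : Tendsto (fun n => (gaussLamGraph lam (χ n)).snd - (hBmem n).toLp _) atTop (𝓝 0) := by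
      rw [tendsto_zero_iff_norm_tendsto_zero]
      have hb : ∀ n, ‖(gaussLamGraph lam (χ n)).snd - (hBmem n).toLp _‖ ≤
          L * ‖(gaussLamGraph lam (ψ n)).snd - U.snd‖ := by
        intro n
        refine Lp.norm_le_mul_norm_of_ae_le_mul ?_
        filter_upwards [Lp.coeFn_sub (gaussLamGraph lam (χ n)).snd ((hBmem n).toLp _),
          Lp.coeFn_sub (gaussLamGraph lam (ψ n)).snd U.snd,
          MemLp.coeFn_toLp (memLp_gradient_planarTestFunction lam (χ n)),
          MemLp.coeFn_toLp (memLp_gradient_planarTestFunction lam (ψ n)),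
          MemLp.coeFn_toLp (hBmem n)] with x hx1 hx2 hx3 hx4 hx5
        rw [hx1, Pi.sub_apply, gaussLamGraph_snd, hx3, hx5, hχ_grad, ← smul_sub, norm_smul,
          hx2, Pi.sub_apply, gaussLamGraph_snd, hx4]
        exact mul_le_mul_of_nonneg_right (hL _) (norm_nonneg _)
      have h0 : Tendsto (fun n => (L : ℝ) * ‖(gaussLamGraph lam (ψ n)).snd - U.snd‖) atTop (𝓝 0) := by
        have := (tendsto_iff_norm_sub_tendsto_zero.1 h2).const_mul (L : ℝ)
        simpa using this
      exact squeeze_zero (fun n => norm_nonneg _) hb h0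
    -- (b) `Bₙ → f'(u) G` by dominated convergence
    have hB : Tendsto (fun n => (hBmem n).toLp _) atTop (𝓝 (hbmem.toLp _)) := by
      have hGi : Integrable (fun x => ‖G x‖ ^ 2) (gaussLamMeasure lam) :=
        (memLp_two_iff_integrable_sq_norm (Lp.aestronglyMeasurable U.snd)).1 (Lp.memLp U.snd)
      have hgi : Integrable (fun x => (2 * (L : ℝ) * ‖G x‖) ^ 2) (gaussLamMeasure lam) :=
        (hGi.const_mul ((2 * (L : ℝ)) ^ 2)).congr (Eventually.of_forall fun x => by ring)
      refine tendsto_toLp_two_of_dominated hBmem hbmem (fun x => 2 * L * ‖G x‖) hgi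
        (fun n => ?_) ?_
      · refine Eventually.of_forall fun x => ?_
        rw [← sub_smul, norm_smul]
        refine mul_le_mul_of_nonneg_right ?_ (norm_nonneg _)
        calc ‖deriv f ((ψ n : EuclideanSpace ℝ (Fin 2) → ℝ) x) - deriv f (u x)‖
            ≤ ‖deriv f ((ψ n : EuclideanSpace ℝ (Fin 2) → ℝ) x)‖ + ‖deriv f (u x)‖ :=
              norm_sub_le _ _
          _ ≤ L + L := add_le_add (hL _) (hL _)
          _ = 2 * L := by ring
      · filter_upwards [hae] with x hx
        exact ((hcontd.tendsto _).comp hx).smul tendsto_const_nhds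
    have h3 : Tendsto (fun n => ((gaussLamGraph lam (χ n)).snd - (hBmem n).toLp _) + (hBmem n).toLp _)
        atTop (𝓝 (0 + hbmem.toLp _)) := hAB.add hB
    rw [zero_add] at h3
    exact h3.congr fun n => sub_add_cancel _ _

end ChainRule

/-! ### Smooth one-sided approximations of `s ↦ s⁻` -/

section Trunc

/-- The derivative of `Real.smoothTransition` vanishes on `(−∞, 0]` and on `[1, ∞)` (a private
copy, with the endpoints included, of `Literature.NumberTheory.Automorphic.deriv_smoothTransition_eq_zero`).
[folklore] -/
private theorem deriv_smoothTransition_eq_zero_of_nonpos_or_one_le {r : ℝ} (hr : r ≤ 0 ∨ 1 ≤ r) :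
    deriv Real.smoothTransition r = 0 := by
  rcases hr with hr | hr
  · -- `θ ≥ 0 = θ r`: a local minimum
    have hmin : IsLocalMin Real.smoothTransition r := by
      refine Filter.Eventually.of_forall fun s => ?_
      rw [Real.smoothTransition.zero_of_nonpos hr]
      exact Real.smoothTransition.nonneg s
    exact hmin.deriv_eq_zero
  · have hmax : IsLocalMax Real.smoothTransition r := by
      refine Filter.Eventually.of_forall fun s => ?_
      rw [Real.smoothTransition.one_of_one_le hr]
      exact Real.smoothTransition.le_one s
    exact hmax.deriv_eq_zero

/-- A uniform bound `M` for `|r θ'(r)|` (`θ'` is continuous and vanishes off `[0,1]`). [folklore] -/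
theorem exists_bound_mul_deriv_smoothTransition :
    ∃ M : ℝ, 0 ≤ M ∧ ∀ r : ℝ, ‖r * deriv Real.smoothTransition r‖ ≤ M := by
  have hcont : Continuous (deriv Real.smoothTransition) :=
    (Real.smoothTransition.contDiff (n := 1)).continuous_deriv (by simp)
  obtain ⟨M, hM⟩ := isCompact_Icc.exists_bound_of_continuousOn (s := Icc (0 : ℝ) 1)
    hcont.continuousOn
  refine ⟨max M 0, le_max_right _ _, fun r => ?_⟩
  by_cases h : 0 < r ∧ r < 1
  · rw [norm_mul]
    calc ‖r‖ * ‖deriv Real.smoothTransition r‖ ≤ 1 * M := by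
          refine mul_le_mul ?_ (hM r ⟨h.1.le, h.2.le⟩) (norm_nonneg _) zero_le_one
          rw [Real.norm_of_nonneg h.1.le]; exact h.2.le
      _ ≤ max M 0 := by rw [one_mul]; exact le_max_left _ _
  · have hr : r ≤ 0 ∨ 1 ≤ r := by
      by_contra hcon; push Not at hcon; exact h ⟨hcon.1, hcon.2⟩
    rw [deriv_smoothTransition_eq_zero_of_nonpos_or_one_le hr, mul_zero, norm_zero]
    exact le_max_right _ _

/-- The smooth one-sided truncation profiles `F_ε(s) = −s θ(−s/ε)`. [folklore] -/
theorem contDiff_truncFun (ε : ℝ) :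
    ContDiff ℝ ∞ fun s : ℝ => -s * Real.smoothTransition (-s / ε) := by
  refine (contDiff_neg.mul (Real.smoothTransition.contDiff.comp ?_))
  exact (contDiff_neg.div_const ε)

/-- The derivative of `F_ε`: `F_ε'(s) = −θ(r) − r θ'(r)`, `r = −s/ε`. [folklore] -/
theorem hasDerivAt_truncFun (ε s : ℝ) :
    HasDerivAt (fun s : ℝ => -s * Real.smoothTransition (-s / ε))
      (-Real.smoothTransition (-s / ε) - (-s / ε) * deriv Real.smoothTransition (-s / ε)) s := by
  have hθ : HasDerivAt Real.smoothTransition (deriv Real.smoothTransition (-s / ε)) (-s / ε) :=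
    ((Real.smoothTransition.contDiff (n := 1)).differentiable (by simp) _).hasDerivAt
  have h1 : HasDerivAt (fun s : ℝ => -s) (-1) s := hasDerivAt_neg s
  have hin : HasDerivAt (fun s : ℝ => -s / ε) (-1 / ε) s := h1.div_const ε
  have h2 : HasDerivAt (fun s : ℝ => Real.smoothTransition (-s / ε))
      (deriv Real.smoothTransition (-s / ε) * (-1 / ε)) s := by
    have h := hθ.comp s hin
    rwa [Function.comp_def] at h
  have hmul : HasDerivAt (fun s : ℝ => -s * Real.smoothTransition (-s / ε))
      (-1 * Real.smoothTransition (-s / ε) +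
        -s * (deriv Real.smoothTransition (-s / ε) * (-1 / ε))) s := h1.mul h2
  convert hmul using 1
  ring

/-- `deriv F_ε`. [folklore] -/
theorem deriv_truncFun (ε s : ℝ) :
    deriv (fun s : ℝ => -s * Real.smoothTransition (-s / ε)) s =
      -Real.smoothTransition (-s / ε) - (-s / ε) * deriv Real.smoothTransition (-s / ε) :=
  (hasDerivAt_truncFun ε s).deriv

/-- Uniform derivative bound `|F_ε'| ≤ 1 + M`. [folklore] -/
theorem norm_deriv_truncFun_le {M : ℝ}
    (hM : ∀ r : ℝ, ‖r * deriv Real.smoothTransition r‖ ≤ M) (ε s : ℝ) :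
    ‖deriv (fun s : ℝ => -s * Real.smoothTransition (-s / ε)) s‖ ≤ 1 + M := by
  rw [deriv_truncFun]
  refine (norm_sub_le _ _).trans (add_le_add ?_ (hM _))
  rw [norm_neg, Real.norm_of_nonneg (Real.smoothTransition.nonneg _)]
  exact Real.smoothTransition.le_one _

/-- `|F_ε(s)| ≤ |s|`. [folklore] -/
theorem norm_truncFun_le (ε s : ℝ) : ‖-s * Real.smoothTransition (-s / ε)‖ ≤ ‖s‖ := by
  rw [norm_mul, norm_neg, Real.norm_of_nonneg (Real.smoothTransition.nonneg _)]
  exact mul_le_of_le_one_right (norm_nonneg _) (Real.smoothTransition.le_one _)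

/-- For `s ≥ 0`: `F_ε(s) = 0` and `F_ε'(s) = 0` (`ε > 0`). [folklore] -/
theorem truncFun_of_nonneg {ε s : ℝ} (hε : 0 < ε) (hs : 0 ≤ s) :
    -s * Real.smoothTransition (-s / ε) = 0 ∧
      deriv (fun s : ℝ => -s * Real.smoothTransition (-s / ε)) s = 0 := by
  have hr : -s / ε ≤ 0 := div_nonpos_of_nonpos_of_nonneg (by linarith) hε.le
  rw [deriv_truncFun, Real.smoothTransition.zero_of_nonpos hr,
    deriv_smoothTransition_eq_zero_of_nonpos_or_one_le (Or.inl hr)]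
  simp

/-- For `s < 0` and `0 < ε ≤ −s`: `F_ε(s) = −s` and `F_ε'(s) = −1`. [folklore] -/
theorem truncFun_of_neg {ε s : ℝ} (hε : 0 < ε) (hs : ε ≤ -s) :
    -s * Real.smoothTransition (-s / ε) = -s ∧
      deriv (fun s : ℝ => -s * Real.smoothTransition (-s / ε)) s = -1 := by
  have hr : 1 ≤ -s / ε := by rw [le_div_iff₀ hε]; linarith
  rw [deriv_truncFun, Real.smoothTransition.one_of_one_le hr,
    deriv_smoothTransition_eq_zero_of_nonpos_or_one_le (Or.inr hr)]
  simp

/-- **Pointwise limits of the truncation profiles** along `ε = 1/(n+1)`: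
`F_ε(s) → max(−s, 0)` and `F_ε'(s) → −1_{s<0}` (both sequences are eventually constant).
[folklore] -/
theorem tendsto_truncFun (s : ℝ) :
    Tendsto (fun n : ℕ => -s * Real.smoothTransition (-s / ((n : ℝ) + 1)⁻¹)) atTop
        (𝓝 (max (-s) 0)) ∧
      Tendsto (fun n : ℕ => deriv (fun s : ℝ => -s * Real.smoothTransition (-s / ((n : ℝ) + 1)⁻¹)) s)
        atTop (𝓝 (if s < 0 then -1 else 0)) := by
  by_cases hs : s < 0
  · rw [if_pos hs, max_eq_left (by linarith)]
    -- eventually `1/(n+1) ≤ -s`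
    obtain ⟨N, hN⟩ := exists_nat_gt (1 / (-s))
    have hev : ∀ n : ℕ, N ≤ n → ((n : ℝ) + 1)⁻¹ ≤ -s := by
      intro n hn
      have hspos : 0 < -s := by linarith
      have h1 : 1 / (-s) < (n : ℝ) + 1 := by
        have : (N : ℝ) ≤ n := by exact_mod_cast hn
        linarith
      rw [inv_le_comm₀ (by positivity) hspos, ← one_div]
      exact h1.le
    constructor
    · refine (tendsto_const_nhds (x := -s)).congr' ?_
      exact Filter.eventually_atTop.2 ⟨N, fun n hn =>
        ((truncFun_of_neg (by positivity) (hev n hn)).1).symm⟩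
    · refine (tendsto_const_nhds (x := (-1 : ℝ))).congr' ?_
      exact Filter.eventually_atTop.2 ⟨N, fun n hn =>
        ((truncFun_of_neg (by positivity) (hev n hn)).2).symm⟩
  · have hs' : 0 ≤ s := not_lt.1 hs
    rw [if_neg hs, max_eq_right (by linarith)]
    constructor
    · refine (tendsto_const_nhds (x := (0 : ℝ))).congr' (Eventually.of_forall fun n => ?_)
      exact ((truncFun_of_nonneg (by positivity) hs').1).symm
    · refine (tendsto_const_nhds (x := (0 : ℝ))).congr' (Eventually.of_forall fun n => ?_)
      exact ((truncFun_of_nonneg (by positivity) hs').2).symm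

end Trunc

/-! ### The negative part in `H¹(μ_λ)` -/

section NegPart

/-- The truncated gradient `−1_{u<0} G` lies in `L²(μ_λ; ℝ²)`. [folklore] -/
theorem memLp_negPartGrad (u : Lp ℝ 2 (gaussLamMeasure lam))
    (G : Lp (EuclideanSpace ℝ (Fin 2)) 2 (gaussLamMeasure lam)) :
    MemLp (fun x => (if (u : EuclideanSpace ℝ (Fin 2) → ℝ) x < 0 then (-1 : ℝ) else 0) •
      (G : EuclideanSpace ℝ (Fin 2) → EuclideanSpace ℝ (Fin 2)) x) 2 (gaussLamMeasure lam) := by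
  have hu : Measurable (u : EuclideanSpace ℝ (Fin 2) → ℝ) := (Lp.stronglyMeasurable u).measurable
  have hc : Measurable fun x => (if (u : EuclideanSpace ℝ (Fin 2) → ℝ) x < 0 then (-1 : ℝ) else 0) :=
    Measurable.ite (measurableSet_lt hu measurable_const) measurable_const measurable_const
  refine MemLp.of_le_mul (c := 1) (Lp.memLp G) (hc.aestronglyMeasurable.smul
    (Lp.aestronglyMeasurable G)) (Eventually.of_forall fun x => ?_)
  rw [norm_smul, one_mul]
  refine mul_le_of_le_one_left (norm_nonneg _) ?_
  split_ifs <;> simp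

/-- **The negative part belongs to the form domain**: for `U = (u, G) ∈ H¹(μ_λ)`,
`(u⁻, −1_{u<0} G) ∈ H¹(μ_λ)` (`u⁻ = max(−u, 0)` is Mathlib's `Lp.negPart`). Proof: the chain rule in
`H` for the smooth profiles `F_ε` (`comp_mem_gaussLamFormDomain`) and dominated convergence
`F_ε(u) → u⁻`, `F_ε'(u) G → −1_{u<0} G` in `L²` as `ε = 1/(n+1) → 0` (Gilbarg–Trudinger, Lemma 7.6,
Gaussian-weighted form). [cite: GilbargTrudinger2001, Lemma 7.6] -/
theorem negPart_mem_gaussLamFormDomain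
    {U : WithLp 2 (Lp ℝ 2 (gaussLamMeasure lam) × Lp (EuclideanSpace ℝ (Fin 2)) 2 (gaussLamMeasure lam))}
    (hU : U ∈ gaussLamFormDomain lam) :
    (toLp 2 (Lp.negPart U.fst, (memLp_negPartGrad U.fst U.snd).toLp _) :
      WithLp 2 (Lp ℝ 2 (gaussLamMeasure lam) ×
        Lp (EuclideanSpace ℝ (Fin 2)) 2 (gaussLamMeasure lam))) ∈ gaussLamFormDomain lam := by
  obtain ⟨M, hM0, hM⟩ := exists_bound_mul_deriv_smoothTransition
  set Lr : ℝ≥0 := ⟨1 + M, by positivity⟩ with hLr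
  -- the profiles `Fₙ = F_{1/(n+1)}`
  set F : ℕ → ℝ → ℝ := fun n s => -s * Real.smoothTransition (-s / ((n : ℝ) + 1)⁻¹) with hF
  have hFc : ∀ n, ContDiff ℝ ∞ (F n) := fun n => contDiff_truncFun _
  have hF0 : ∀ n, F n 0 = 0 := fun n => by simp [hF]
  have hFL : ∀ n s, ‖deriv (F n) s‖ ≤ Lr := fun n s => by
    rw [hLr]; exact norm_deriv_truncFun_le hM _ s
  set u : EuclideanSpace ℝ (Fin 2) → ℝ := (U.fst : EuclideanSpace ℝ (Fin 2) → ℝ) with hu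
  set G : EuclideanSpace ℝ (Fin 2) → EuclideanSpace ℝ (Fin 2) :=
    (U.snd : EuclideanSpace ℝ (Fin 2) → EuclideanSpace ℝ (Fin 2)) with hG
  have hmem := fun n => comp_mem_gaussLamFormDomain (hFc n) (hF0 n) (hFL n) hU
  refine mem_gaussLamFormDomain_of_tendsto hmem ?_ ?_
  · -- first components `Fₙ ∘ u → u⁻`
    simp only [WithLp.toLp_fst]
    have hAmem : ∀ n, MemLp (fun x => F n (u x)) 2 (gaussLamMeasure lam) := fun n =>
      (lipschitzWith_of_deriv_bound ((hFc n).of_le (by simp)) (hFL n)).comp_memLp (hF0 n)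
        (Lp.memLp U.fst)
    have hamem : MemLp (fun x => max (-u x) 0) 2 (gaussLamMeasure lam) := (Lp.memLp U.fst).neg_part
    have heqA : ∀ n, (lipschitzWith_of_deriv_bound ((hFc n).of_le (by simp)) (hFL n)).compLp
        (hF0 n) U.fst = (hAmem n).toLp _ := fun n =>
      Lp.ext (((LipschitzWith.coeFn_compLp _ _ _)).trans (MemLp.coeFn_toLp (hAmem n)).symm)
    have hneg : ((Lp.negPart U.fst : Lp ℝ 2 (gaussLamMeasure lam)) : EuclideanSpace ℝ (Fin 2) → ℝ)
        =ᵐ[gaussLamMeasure lam] fun x => max (-u x) 0 := Lp.coeFn_negPart_eq_max U.fst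
    have heqa : Lp.negPart U.fst = hamem.toLp _ :=
      Lp.ext (hneg.trans (MemLp.coeFn_toLp hamem).symm)
    simp_rw [heqA, heqa]
    have hui : Integrable (fun x => ‖u x‖ ^ 2) (gaussLamMeasure lam) :=
      (memLp_two_iff_integrable_sq_norm (Lp.aestronglyMeasurable U.fst)).1 (Lp.memLp U.fst)
    have hgi : Integrable (fun x => (2 * ‖u x‖) ^ 2) (gaussLamMeasure lam) :=
      (hui.const_mul ((2 : ℝ) ^ 2)).congr (Eventually.of_forall fun x => by ring)
    refine tendsto_toLp_two_of_dominated hAmem hamem (fun x => 2 * ‖u x‖) hgi (fun n => ?_) ?_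
    · refine Eventually.of_forall fun x => (norm_sub_le _ _).trans ?_
      have h1 : ‖F n (u x)‖ ≤ ‖u x‖ := norm_truncFun_le _ _
      have h2 : ‖max (-u x) 0‖ ≤ ‖u x‖ := by
        rw [Real.norm_eq_abs, Real.norm_eq_abs, abs_le]
        constructor
        · have := le_max_right (-u x) 0; have := abs_nonneg (u x); linarith
        · exact max_le (by rw [← abs_neg]; exact le_abs_self _) (abs_nonneg _)
      linarith
    · exact Eventually.of_forall fun x => (tendsto_truncFun (u x)).1
  · -- second components `Fₙ'(u) G → −1_{u<0} G`
    simp only [WithLp.toLp_snd]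
    have hGi : Integrable (fun x => ‖G x‖ ^ 2) (gaussLamMeasure lam) :=
      (memLp_two_iff_integrable_sq_norm (Lp.aestronglyMeasurable U.snd)).1 (Lp.memLp U.snd)
    have hgi : Integrable (fun x => (((Lr : ℝ) + 1) * ‖G x‖) ^ 2) (gaussLamMeasure lam) :=
      (hGi.const_mul (((Lr : ℝ) + 1) ^ 2)).congr (Eventually.of_forall fun x => by ring)
    refine tendsto_toLp_two_of_dominated _ _ (fun x => (Lr + 1) * ‖G x‖) hgi (fun n => ?_) ?_
    · refine Eventually.of_forall fun x => ?_
      rw [← sub_smul, norm_smul]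
      refine mul_le_mul_of_nonneg_right ((norm_sub_le _ _).trans (add_le_add (hFL n _) ?_))
        (norm_nonneg _)
      split_ifs <;> simp
    · exact Eventually.of_forall fun x => ((tendsto_truncFun (u x)).2).smul tendsto_const_nhds

/-- `u · u⁻ = −(u⁻)²` pointwise. [folklore] -/
theorem mul_negPart_eq (t : ℝ) : t * max (-t) 0 = -(max (-t) 0) ^ 2 := by
  rcases le_or_gt t 0 with h | h
  · rw [max_eq_left (by linarith)]; ring
  · rw [max_eq_right (by linarith)]; ring

/-- `⟪G, −1_{u<0} G⟫ = −‖−1_{u<0} G‖²` pointwise. [folklore] -/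
theorem inner_negPartGrad_eq (t : ℝ) (g : EuclideanSpace ℝ (Fin 2)) :
    ⟪g, (if t < 0 then (-1 : ℝ) else 0) • g⟫ = -‖(if t < 0 then (-1 : ℝ) else 0) • g‖ ^ 2 := by
  split_ifs
  · rw [inner_smul_right, real_inner_self_eq_norm_sq, norm_smul]; simp
  · simp

/-- `u • G⁻ = −u⁻ • G⁻` pointwise (`G⁻ = −1_{u<0} G` vanishes where `u ≥ 0`). [folklore] -/
theorem smul_negPartGrad_eq (t : ℝ) (g : EuclideanSpace ℝ (Fin 2)) :
    t • ((if t < 0 then (-1 : ℝ) else 0) • g) = -(max (-t) 0) • ((if t < 0 then (-1 : ℝ) else 0) • g) := by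
  split_ifs with h
  · rw [max_eq_left (by linarith)]; simp
  · simp

/-- `u⁻ • G⁻ = u⁻ • (−G)`: on `{u < 0}` the truncated gradient is `−G`. [folklore] -/
theorem negPart_smul_negPartGrad_eq (t : ℝ) (g : EuclideanSpace ℝ (Fin 2)) :
    (max (-t) 0) • ((if t < 0 then (-1 : ℝ) else 0) • g) = (max (-t) 0) • (-g) := by
  split_ifs with h
  · simp
  · rw [max_eq_right (by linarith)]; simp

end NegPart

end Literature.Analysis.FluidPDE
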